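import Mathlib
import HarnessLib
import Literature.Computability.AlgebraicComplexity.ValiantClassesProofs

/-!
# Block projection is free for the circuit complexity over `ℝ≥0`
(crux `stmt-ValiantsHypothesis-15886`, line `Sketch`, registered stub `stub_blockProjection`, B3)

Helper file (`--supports stmt-ValiantsHypothesis-15886`) of line `Sketch` of the crux
`Summit.ValiantsHypothesis.ValiantsHypothesis.Theses.MonotoneRestoration.MonotoneRestorationQP`
(Theorem β, step B3). A polynomial `f` in the `n × n` matrix variables over the semiring `ℝ≥0`
is restricted to its top-left `k × k` block (`k ≤ n`) by killing every variable outside the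
block: `g = MvPolynomial.killCompl hι f` for the injective block embedding
`ι (i, j) = (Fin.castLE hkn i, Fin.castLE hkn j)`. This substitutes a variable or the constant
`0` for each variable of `f`, so `g` is a Valiant projection of `f` (`IsProjection g f`) and
`L(g) ≤ L(f)` for the tree's fan-in-two circuit complexity (`complexity_le_of_isProjection`,
Bürgisser 2000, Rem. 2.7: substituting variables and constants for the inputs of a minimal
circuit is free); the coefficients of `g` are those of `f` on the block
(`MvPolynomial.coeff_killCompl`).

## Main statements

* `MonotoneBlockProjection.isProjection_killCompl` — `killCompl hf p` is a projection of `p`;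
* `MonotoneBlockProjection.blockEmb_injective` — the block embedding is injective;
* `stub_blockProjection` — the registered stub.
-/

-- `ValiantsHypothesis.ValiantsHypothesis`: the D-0017 layout repeats the problem name in the path.
set_option linter.dupNamespace false

noncomputable section

namespace Summit.ValiantsHypothesis.ValiantsHypothesis.Theorems

open Literature.Computability.AlgebraicComplexity MvPolynomial

namespace MonotoneBlockProjection

/-- Killing the variables outside the range of an injective map `f : σ → τ`
(`MvPolynomial.killCompl hf = aeval (X ∘ f⁻¹ on range f, 0 elsewhere)`) substitutes a variable
or the constant `0 = C 0` for each variable, so `killCompl hf p` is a Valiant projection of `p`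
(Bürgisser 2000, Def. 2.6(1) and Rem. 2.7). [cite: Burgisser2000, Rem. 2.7] -/
theorem isProjection_killCompl {R : Type*} [CommSemiring R] {σ τ : Type*} {f : σ → τ}
    (hf : Function.Injective f) (p : MvPolynomial τ R) :
    IsProjection (killCompl hf p) p := by
  unfold killCompl
  refine ⟨_, fun i => ?_, rfl⟩
  by_cases h : i ∈ Set.range f
  · exact Or.inl ⟨_, dif_pos h⟩
  · exact Or.inr ⟨0, by rw [dif_neg h, C_0]⟩

/-- The top-left block embedding `Fin k × Fin k → Fin n × Fin n`, `(i, j) ↦ (i, j)` along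
`Fin.castLE hkn` in both coordinates, is injective. [folklore] -/
theorem blockEmb_injective {n k : ℕ} (hkn : k ≤ n) :
    Function.Injective (fun p : Fin k × Fin k => (Fin.castLE hkn p.1, Fin.castLE hkn p.2)) :=
  fun _ _ h => Prod.ext (Fin.castLE_injective hkn (Prod.mk.inj h).1)
    (Fin.castLE_injective hkn (Prod.mk.inj h).2)

end MonotoneBlockProjection

open MonotoneBlockProjection in
/-- **B3 — block projection is free for monotone complexity.** For `k ≤ n` and `f` over `ℝ≥0`
in the `n × n` matrix variables, killing every variable outside the top-left `k × k` block
(`MvPolynomial.killCompl` along the block embedding `(i, j) ↦ (Fin.castLE hkn i, Fin.castLE hkn j)`)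
gives `g` on `Fin k × Fin k` with `L(g) ≤ L(f)` — a Valiant projection does not increase the
tree's `complexity` (`complexity_le_of_isProjection`, Bürgisser 2000, Rem. 2.7) — whose
coefficient at `d` is the coefficient of `f` at the embedded exponent (`coeff_killCompl`).
[cite: Burgisser2000, Rem. 2.7] -/
theorem stub_blockProjection {n k : ℕ} (hkn : k ≤ n) (f : MvPolynomial (Fin n × Fin n) NNReal) :
    ∃ g : MvPolynomial (Fin k × Fin k) NNReal,
      complexity g ≤ complexity f ∧
      ∀ d : Fin k × Fin k →₀ ℕ, MvPolynomial.coeff d g =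
        MvPolynomial.coeff (Finsupp.mapDomain
          (fun p : Fin k × Fin k => (Fin.castLE hkn p.1, Fin.castLE hkn p.2)) d) f :=
  ⟨killCompl (blockEmb_injective hkn) f,
    complexity_le_of_isProjection (isProjection_killCompl (blockEmb_injective hkn) f),
    fun _ => coeff_killCompl (blockEmb_injective hkn)⟩

end Summit.ValiantsHypothesis.ValiantsHypothesis.Theorems
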